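import Summits.Ventures.CertifiedManyBodySolver.Downfold.EmeryLoewdinLevel
import Literature.MathematicalPhysics.QuantumLattice.LoewdinDownfolding
import HarnessLib

/-!
# Bridge: the σ three-band `(d | p_x, p_y)` block data fed to lit-1's `Loewdin.effHam` IS the scalar Löwdin level of
# `EmeryLoewdinLevel`, and the Schur factorisation of `LoewdinDownfolding` reproduces `charCubic`

Venture CertifiedManyBodySolver, cell `pub/hubbard-downfold` (technique B ↔ Literature Löwdin kernel), seat hubbard-downfold-mod-4;
namespace `Summit.Ventures.CertifiedManyBodySolver.Downfold.Emery`. Closes the loop announced on the cell bus (lit-1 2026-08-27T12:51:34Z,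
`Literature/MathematicalPhysics/QuantumLattice/LoewdinDownfolding` p530893: `effHam A B C D ε = A − B (D − ε)⁻¹ C`,
`det_sub_smul_one_eq`) with the band-side file `EmeryLoewdinLevel` (`loewdinLevel = loewdinNum / minorD`,
`charCubic_eq_minorD_mul_sub`, `dWeight_eq_inv_one_sub_deriv`).

The block data of `bloch4 Δ t_pd t_pp c sx sy` in the ordering (active `d` | passive `p_x, p_y`), gauge `ε_d = 0`:
`blochA = !![0]`, `blochB = !![2t_pd sx, −2t_pd sy]`, `blochC = blochBᵀ`, `blochD = !![−Δ − 4c sx², −4t_pp sx sy; −4t_pp sx sy, −Δ − 4c sy²]`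
(so `fromBlocks blochA blochB blochC blochD` is `bloch4` with its rows/columns read in the order `d, p_x, p_y` — the same matrix
up to the `Fin 1 ⊕ Fin 2 ≃ Fin 3` relabelling; we do not transport along the equivalence, we recompute the two invariants).

* `det_blochD_sub` — `det(blochD − ε) = minorD` (the passive determinant of `EmeryOrbitalWeight`);
* `effHam_bloch_eq` — off the passive spectrum (`minorD ≠ 0`), `Loewdin.effHam blochA blochB blochC blochD ε = !![loewdinLevel …]`
  (the 2 × 2 resolvent written as `adjugate/det`);
* `det_fromBlocks_bloch_sub` — by lit-1's `det_sub_smul_one_eq`: `det(fromBlocks … − ε) = minorD · (loewdinLevel − ε) = −charCubic`,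
  i.e. the Literature factorisation lands exactly on the band-side secular cubic (`EmeryFermiSurfaceShape.charCubic`).

Everything here is PROVED (0 sorry); matrix algebra on explicit `Fin 1`/`Fin 2` blocks; nothing about any material.
-/

namespace Summit.Ventures.CertifiedManyBodySolver.Downfold.Emery

open Matrix Literature.MathematicalPhysics.QuantumLattice

noncomputable section

/-- Active block (`d`, gauge `ε_d = 0`). [folklore] -/
def blochA : Matrix (Fin 1) (Fin 1) ℝ := !![0]

/-- Hybridisation row `V_dp = (2t_pd sx, −2t_pd sy)`. [folklore] -/
def blochB (tpd sx sy : ℝ) : Matrix (Fin 1) (Fin 2) ℝ := !![2 * tpd * sx, -2 * tpd * sy]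

/-- Hybridisation column `V_pd = V_dpᵀ`. [folklore] -/
def blochC (tpd sx sy : ℝ) : Matrix (Fin 2) (Fin 1) ℝ := !![2 * tpd * sx; -2 * tpd * sy]

/-- Passive block (`p_x, p_y`): levels `−Δ − 4c s²` and the O–O coupling `−4t_pp sx sy`. [folklore] -/
def blochD (Δ tpp c sx sy : ℝ) : Matrix (Fin 2) (Fin 2) ℝ :=
  !![-Δ - 4 * c * sx ^ 2, -4 * tpp * sx * sy; -4 * tpp * sx * sy, -Δ - 4 * c * sy ^ 2]

/-- The shifted passive block, entrywise. [folklore] -/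
theorem blochD_sub_smul_one (Δ tpp c sx sy ε : ℝ) :
    blochD Δ tpp c sx sy - ε • (1 : Matrix (Fin 2) (Fin 2) ℝ) =
      !![-Δ - 4 * c * sx ^ 2 - ε, -4 * tpp * sx * sy; -4 * tpp * sx * sy, -Δ - 4 * c * sy ^ 2 - ε] := by
  ext i j
  fin_cases i <;> fin_cases j <;> simp [blochD, Matrix.smul_apply, Matrix.sub_apply]

/-- **The passive determinant is `minorD`.** [folklore] -/
theorem det_blochD_sub (Δ tpp c sx sy ε : ℝ) :
    (blochD Δ tpp c sx sy - ε • (1 : Matrix (Fin 2) (Fin 2) ℝ)).det = minorD Δ tpp c (sx ^ 2) (sy ^ 2) ε := by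
  rw [blochD_sub_smul_one, Matrix.det_fin_two_of]
  unfold minorD
  ring

/-- **Löwdin's effective Hamiltonian on the `d` block is the scalar `loewdinLevel`** (off the passive spectrum). [folklore] -/
theorem effHam_bloch_eq {Δ tpd tpp c sx sy ε : ℝ} (hD : minorD Δ tpp c (sx ^ 2) (sy ^ 2) ε ≠ 0) :
    Loewdin.effHam blochA (blochB tpd sx sy) (blochC tpd sx sy) (blochD Δ tpp c sx sy) ε =
      !![loewdinLevel Δ tpd tpp c (sx ^ 2) (sy ^ 2) ε] := by
  rw [Loewdin.effHam_def, blochD_sub_smul_one, Matrix.inv_def, Matrix.det_fin_two_of, Matrix.adjugate_fin_two_of]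
  have hdet : (-Δ - 4 * c * sx ^ 2 - ε) * (-Δ - 4 * c * sy ^ 2 - ε) - -4 * tpp * sx * sy * (-4 * tpp * sx * sy) =
      minorD Δ tpp c (sx ^ 2) (sy ^ 2) ε := by unfold minorD; ring
  rw [hdet, Ring.inverse_eq_inv']
  ext i j
  fin_cases i; fin_cases j
  simp [blochA, blochB, blochC, loewdinLevel]
  unfold loewdinNum
  field_simp
  ring

/-- **The Literature factorisation reproduces the secular cubic**: off the passive spectrum,
`det(fromBlocks blochA blochB blochC blochD − ε) = minorD·(loewdinLevel − ε) = −charCubic`. [folklore] -/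
theorem det_fromBlocks_bloch_sub {Δ tpd tpp c sx sy ε : ℝ} (hD : minorD Δ tpp c (sx ^ 2) (sy ^ 2) ε ≠ 0) :
    (fromBlocks blochA (blochB tpd sx sy) (blochC tpd sx sy) (blochD Δ tpp c sx sy)
        - ε • (1 : Matrix (Fin 1 ⊕ Fin 2) (Fin 1 ⊕ Fin 2) ℝ)).det
      = -charCubic Δ tpd tpp c (sx ^ 2) (sy ^ 2) ε := by
  have hunit : IsUnit (blochD Δ tpp c sx sy - ε • (1 : Matrix (Fin 2) (Fin 2) ℝ)).det := by
    rw [det_blochD_sub]; exact isUnit_iff_ne_zero.2 hD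
  rw [Loewdin.det_sub_smul_one_eq _ _ _ _ _ hunit, det_blochD_sub, effHam_bloch_eq hD,
    charCubic_eq_minorD_mul_sub (tpd := tpd) hD]
  have h1 : (!![loewdinLevel Δ tpd tpp c (sx ^ 2) (sy ^ 2) ε] - ε • (1 : Matrix (Fin 1) (Fin 1) ℝ)).det =
      loewdinLevel Δ tpd tpp c (sx ^ 2) (sy ^ 2) ε - ε := by
    rw [Matrix.det_unique]
    simp [Matrix.sub_apply, Matrix.smul_apply]
  rw [h1]
  ring

end

end Summit.Ventures.CertifiedManyBodySolver.Downfold.Emery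

/-! ## §2 The Literature's model-space weight and fold derivative ARE `dWeight` and `loewdinLevelDeriv`
(the `m = 1` instance of `LoewdinDownfolding` §8, p538366; appended 2026-08-27 by hubbard-downfold-mod-4 g9)

For the `(d | p_x, p_y)` blocks of §1: `blochC = blochBᴴ` and `blochD` is Hermitian (real symmetric), so lit-1's §8 applies verbatim.
* `hasDerivAt_effHam_bloch` / `loewdinLevelDeriv_eq_neg_sandwich` — the honest energy derivative of the Literature fold's single entry
  is the band-side closed form: `∂_ε (effHam …)₀₀ = −(B R R C)₀₀ = loewdinLevelDeriv` (`R = (blochD − ε)⁻¹`; uniqueness of derivatives,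
  the two functions agreeing near `ε` because `minorD ≠ 0` is an open condition);
* `dWeight_eq_inv_one_add_sandwich` — on the contour `dWeight = (1 + (B R R C)₀₀)⁻¹`;
* `dWeight_eq_loewdinActiveWeight` — for ANY non-zero active amplitude `x : Fin 1 → ℝ` with its exact passive tail `y = −R Bᴴ x`
  (lit-1 §3 `lift_passive_eq`), the model-space weight `⟨x,x⟩/(⟨x,x⟩ + ⟨y,y⟩)` of lit-1's `activeWeight_eq_unique` EQUALS the
  technique-B Cu-d weight `dWeight` of `EmeryOrbitalWeight` — i.e. the d-weight `a²` that router/TECHNIQUE-B-ROWS prints per σ set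
  (and that feeds the `U_B` annex of `EmeryBandLevelU`) is the Literature's Bloch–Horowitz/Lepage normalisation weight, exactly.
Everything PROVED (0 sorry); no material content. -/

namespace Summit.Ventures.CertifiedManyBodySolver.Downfold.Emery

open Matrix Filter Literature.MathematicalPhysics.QuantumLattice
open scoped _root_.Topology

noncomputable section

/-- `blochC = blochBᴴ` (real entries: the conjugate transpose is the transpose). [folklore] -/
theorem blochC_eq_conjTranspose (tpd sx sy : ℝ) : blochC tpd sx sy = (blochB tpd sx sy)ᴴ := by
  ext i j
  fin_cases i <;> fin_cases j <;> simp [blochB, blochC, Matrix.conjTranspose_apply]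

/-- The passive block `blochD` is Hermitian (real symmetric). [folklore] -/
theorem blochD_isHermitian (Δ tpp c sx sy : ℝ) : (blochD Δ tpp c sx sy).IsHermitian := by
  unfold Matrix.IsHermitian
  ext i j
  fin_cases i <;> fin_cases j <;> simp [blochD, Matrix.conjTranspose_apply]

/-- Off the passive spectrum the shifted passive block has unit determinant (`= minorD ≠ 0`). [folklore] -/
theorem isUnit_det_blochD_sub {Δ tpp c sx sy ε : ℝ} (hD : minorD Δ tpp c (sx ^ 2) (sy ^ 2) ε ≠ 0) :
    IsUnit (blochD Δ tpp c sx sy - ε • (1 : Matrix (Fin 2) (Fin 2) ℝ)).det := by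
  rw [det_blochD_sub]; exact isUnit_iff_ne_zero.2 hD

/-- The single entry of the Literature fold is `loewdinLevel` (off the passive spectrum). [folklore] -/
theorem effHam_bloch_apply {Δ tpd tpp c sx sy ε : ℝ} (hD : minorD Δ tpp c (sx ^ 2) (sy ^ 2) ε ≠ 0) :
    Loewdin.effHam blochA (blochB tpd sx sy) (blochC tpd sx sy) (blochD Δ tpp c sx sy) ε default default =
      loewdinLevel Δ tpd tpp c (sx ^ 2) (sy ^ 2) ε := by
  rw [effHam_bloch_eq hD]
  simp

/-- **The fold derivative is the band-side closed form**: off the passive spectrum,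
`loewdinLevelDeriv = −(B R R C)₀₀` with `R = (blochD − ε)⁻¹` — lit-1's `hasDerivAt_effHam_apply` and the band-side
`hasDerivAt_loewdinLevel` differentiate functions that agree near `ε`, so the derivatives coincide. [folklore] -/
theorem loewdinLevelDeriv_eq_neg_sandwich {Δ tpd tpp c sx sy ε : ℝ} (hD : minorD Δ tpp c (sx ^ 2) (sy ^ 2) ε ≠ 0) :
    loewdinLevelDeriv Δ tpd tpp c (sx ^ 2) (sy ^ 2) ε =
      -((blochB tpd sx sy * Loewdin.passiveRes (blochD Δ tpp c sx sy) ε * Loewdin.passiveRes (blochD Δ tpp c sx sy) ε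
          * blochC tpd sx sy) default default) := by
  have h1 := hasDerivAt_loewdinLevel (tpd := tpd) hD
  have h2 := Loewdin.hasDerivAt_effHam_apply blochA (blochB tpd sx sy) (blochC tpd sx sy) (blochD Δ tpp c sx sy)
    (isUnit_det_blochD_sub hD) default default
  have hcont : Continuous fun e : ℝ => minorD Δ tpp c (sx ^ 2) (sy ^ 2) e := by
    unfold minorD; fun_prop
  have hev : (fun e => loewdinLevel Δ tpd tpp c (sx ^ 2) (sy ^ 2) e) =ᶠ[𝓝 ε]
      fun e => Loewdin.effHam blochA (blochB tpd sx sy) (blochC tpd sx sy) (blochD Δ tpp c sx sy) e default default := by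
    filter_upwards [hcont.continuousAt.eventually_ne hD] with e he
    exact (effHam_bloch_apply (tpd := tpd) he).symm
  exact h1.unique (h2.congr_of_eventuallyEq hev)

/-- **The honest derivative of the Literature fold's entry, in closed form**: off the passive spectrum,
`HasDerivAt (ε ↦ (effHam …)₀₀) loewdinLevelDeriv ε`. [folklore] -/
theorem hasDerivAt_effHam_bloch {Δ tpd tpp c sx sy ε : ℝ} (hD : minorD Δ tpp c (sx ^ 2) (sy ^ 2) ε ≠ 0) :
    HasDerivAt (fun e => Loewdin.effHam blochA (blochB tpd sx sy) (blochC tpd sx sy) (blochD Δ tpp c sx sy) e default default)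
      (loewdinLevelDeriv Δ tpd tpp c (sx ^ 2) (sy ^ 2) ε) ε := by
  rw [loewdinLevelDeriv_eq_neg_sandwich (tpd := tpd) hD]
  exact Loewdin.hasDerivAt_effHam_apply blochA (blochB tpd sx sy) (blochC tpd sx sy) (blochD Δ tpp c sx sy)
    (isUnit_det_blochD_sub hD) default default

/-- **`dWeight = (1 + (B R R C)₀₀)⁻¹` on the contour** (off the passive spectrum): the `Z = (1 − ∂_ε H_eff)⁻¹` form with the
Literature sandwich `S = B R² C = −∂_ε H_eff`. [folklore] -/
theorem dWeight_eq_inv_one_add_sandwich {Δ tpd tpp c sx sy ε : ℝ} (hP : charCubic Δ tpd tpp c (sx ^ 2) (sy ^ 2) ε = 0)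
    (hD : minorD Δ tpp c (sx ^ 2) (sy ^ 2) ε ≠ 0) :
    dWeight Δ tpd tpp c (sx ^ 2) (sy ^ 2) ε =
      (1 + (blochB tpd sx sy * Loewdin.passiveRes (blochD Δ tpp c sx sy) ε * Loewdin.passiveRes (blochD Δ tpp c sx sy) ε
          * blochC tpd sx sy) default default)⁻¹ := by
  rw [dWeight_eq_inv_one_sub_deriv hP hD, loewdinLevelDeriv_eq_neg_sandwich (tpd := tpd) hD, sub_neg_eq_add]

/-- **TECHNIQUE B's Cu-d WEIGHT IS THE LITERATURE'S MODEL-SPACE WEIGHT.** On the contour (`charCubic = 0`), off the passive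
spectrum (`minorD ≠ 0`): for every non-zero active amplitude `x : Fin 1 → ℝ`, with the exact passive tail
`y = −(blochD − ε)⁻¹ blochBᴴ x` of the block eigenvector (lit-1 §3), the model-space weight `⟨x,x⟩/(⟨x,x⟩ + ⟨y,y⟩)` of
`Loewdin.activeWeight_eq_unique` equals `dWeight` of `EmeryOrbitalWeight`. [folklore] -/
theorem dWeight_eq_loewdinActiveWeight {Δ tpd tpp c sx sy ε : ℝ} (hP : charCubic Δ tpd tpp c (sx ^ 2) (sy ^ 2) ε = 0)
    (hD : minorD Δ tpp c (sx ^ 2) (sy ^ 2) ε ≠ 0) (x : Fin 1 → ℝ) (hx : x default ≠ 0) :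
    star x ⬝ᵥ x / (star x ⬝ᵥ x
        + star (-((Loewdin.passiveRes (blochD Δ tpp c sx sy) ε * (blochB tpd sx sy)ᴴ) *ᵥ x))
            ⬝ᵥ (-((Loewdin.passiveRes (blochD Δ tpp c sx sy) ε * (blochB tpd sx sy)ᴴ) *ᵥ x)))
      = dWeight Δ tpd tpp c (sx ^ 2) (sy ^ 2) ε := by
  have hx' : star (x default) * x default ≠ 0 := by
    rw [star_trivial]; exact mul_ne_zero hx hx
  rw [Loewdin.activeWeight_eq_unique (blochD_isHermitian Δ tpp c sx sy) (IsSelfAdjoint.all ε) x hx',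
    ← blochC_eq_conjTranspose, dWeight_eq_inv_one_add_sandwich hP hD]

end

end Summit.Ventures.CertifiedManyBodySolver.Downfold.Emery

/-! ## §3 The ACTIVE-LEVEL LEVER of the antibonding band IS `dWeight` (instance of lit-1's `LoewdinDownfolding` §9, p546186; appended
2026-08-27 by hubbard-downfold-mod-4 g9)

`EmeryOrbitalWeight`'s docstring says `dWeight = ∂E/∂ε_d` «by Hellmann–Feynman (prose)». With lit-1's `activeShift_eigenvalue_deriv_eq`
(dλ/ds = (1 + S)⁻¹ for a differentiable branch of band energies of the problem with the KEPT level shifted by `s`) and §2's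
`dWeight_eq_inv_one_add_sandwich` this is now a kernel statement for the σ three-band blocks: the rate at which an antibonding band energy
follows a shift of the Cu-d level is the technique-B Cu-d weight. This is the mechanism behind the cell's 3BE LEVEL TAGS (lit-1 REFVALS-1 §C21
addendum 2: a 1–3 eV reference-level difference moves a three-band-derived one-band `t` by 12–45 %). -/

namespace Summit.Ventures.CertifiedManyBodySolver.Downfold.Emery

open Matrix Filter Literature.MathematicalPhysics.QuantumLattice
open scoped _root_.Topology

noncomputable section

/-- **`∂ε_AB/∂ε_d = dWeight`**: if `s ↦ lam s` is a differentiable branch of band energies of the σ three-band problem with the Cu-d level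
shifted by `s` (the folded secular equation `lam s = (H^eff(lam s))₀₀ + s` near `s = 0`), off the passive spectrum at `lam 0`, then
`lam′(0) = dWeight … (lam 0)`. [folklore] -/
theorem deriv_band_dLevelShift_eq_dWeight {Δ tpd tpp c sx sy : ℝ} {lam : ℝ → ℝ} {lam' : ℝ}
    (hlam : HasDerivAt lam lam' 0) (hD : minorD Δ tpp c (sx ^ 2) (sy ^ 2) (lam 0) ≠ 0)
    (hfix : ∀ᶠ s in 𝓝 (0 : ℝ), lam s =
      Loewdin.effHam blochA (blochB tpd sx sy) (blochC tpd sx sy) (blochD Δ tpp c sx sy) (lam s) default default + s) :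
    lam' = dWeight Δ tpd tpp c (sx ^ 2) (sy ^ 2) (lam 0) := by
  have h1 := Loewdin.activeShift_eigenvalue_deriv_eq blochA (blochB tpd sx sy) (blochC tpd sx sy) (blochD Δ tpp c sx sy)
    hlam (isUnit_det_blochD_sub hD) hfix
  have h0 : lam 0 = loewdinLevel Δ tpd tpp c (sx ^ 2) (sy ^ 2) (lam 0) := by
    have h := hfix.self_of_nhds
    rw [effHam_bloch_apply (tpd := tpd) hD, add_zero] at h
    exact h
  have hP : charCubic Δ tpd tpp c (sx ^ 2) (sy ^ 2) (lam 0) = 0 := by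
    rw [charCubic_eq_minorD_mul_sub (tpd := tpd) hD, ← h0, sub_self, mul_zero]
  rw [h1, dWeight_eq_inv_one_add_sandwich hP hD]

/-- The same lever in product form (no inverse): `lam′(0) · ∂_ε charCubic = minorD` at `lam 0`. [folklore] -/
theorem deriv_band_dLevelShift_mul_dcharCubic {Δ tpd tpp c sx sy : ℝ} {lam : ℝ → ℝ} {lam' : ℝ}
    (hlam : HasDerivAt lam lam' 0) (hD : minorD Δ tpp c (sx ^ 2) (sy ^ 2) (lam 0) ≠ 0)
    (hdP : dcharCubic Δ tpd tpp c (sx ^ 2) (sy ^ 2) (lam 0) ≠ 0)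
    (hfix : ∀ᶠ s in 𝓝 (0 : ℝ), lam s =
      Loewdin.effHam blochA (blochB tpd sx sy) (blochC tpd sx sy) (blochD Δ tpp c sx sy) (lam s) default default + s) :
    lam' * dcharCubic Δ tpd tpp c (sx ^ 2) (sy ^ 2) (lam 0) = minorD Δ tpp c (sx ^ 2) (sy ^ 2) (lam 0) := by
  rw [deriv_band_dLevelShift_eq_dWeight hlam hD hfix, dWeight_eq_div_dcharCubic, div_mul_cancel₀ _ hdP]

end

end Summit.Ventures.CertifiedManyBodySolver.Downfold.Emery
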